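import Literature.AlgebraicGeometry.Frobenioids.BiratPathsDiv
import Literature.AlgebraicGeometry.Frobenioids.BiratPathsExist
import Literature.AlgebraicGeometry.Frobenioids.BiratFrobeniusFactor
import Literature.AlgebraicGeometry.Frobenioids.ModelFrobenioidComparison
import HarnessLib

/-!
# Frobenioids I, Theorem 5.2 (iv), proof step: the factorisation `pathHom φ = F(d)^birat ≫ u ≫
π^birat` and the divisor of its unit part

Mochizuki, *The geometry of Frobenioids I: the general theory*, Kyushu J. Math. **62** (2008)
293–400, §5, proof of Theorem 5.2 (iv), kurims text p. 102 [cite: MochizukiFrdI2008, Thm. 5.2(iv)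
p.102]:
"every morphism `ψ` of `E` admits a unique factorization `ψ = ψ_P ∘ ψ_{O^×} ∘ ψ_F` in `E`, where
`ψ_P`
is `P`-distinguished; `ψ_{O^×}` is a base-identity automorphism; `ψ_F` is `F`-distinguished."

For a base-Frobenius pair `(P, F)` of a Frobenioid of isotropic type and `φ : X → X'` between
objects
with `F_P`-paths `p, p'` (so `A = p.A`, `A' = p'.A ∈ Ob(P)`), the conjugated birational morphism
`ψ := pathHom φ : A^birat → A'^birat` factors as `ψ = F(d)_A^birat ≫ u ≫ π^birat` with `d = deg_Fr
φ`,
`π` THE `P`-morphism over `baseOf φ` (the `P → D` equivalence), and `u ∈ O^×(A^birat)`: lift `ψ`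
along
the pull-back morphism `π^birat` of `C^birat` (`isPullbackMorphism_toBirat_map`) to a base-identity
`ψ₀` and take the unit factor of `ψ₀` along `F(d)_A` (`BiratFrobeniusFactor.lean`).  Given the `F`-
and
`P`-parts the unit is unique, and its divisor is `divHom u = Div(ψ)` — so `u`, read in `B(A_D)`
through
the rational-function-monoid isomorphism, satisfies relation (d) (`UnitData.divB_unit`).
-/

namespace Literature.AlgebraicGeometry.Frobenioids

open CategoryTheory Opposite

universe w v v' u u'

namespace PreFrobenioid

namespace FPPath

variable {D : Type u} [Category.{v} D] {Φ : Dᵒᵖ ⥤ CommMonCat.{w}}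
  {C : Type u'} [Category.{v'} C] {F : C ⥤ ElemFrobenioid Φ} {hF : IsFrobenioid F}
  {hsq : HasBiratSquares F} {P : Presection C} {Fr : ℕ+ →* CategoryTheory.End P.ι} {X X' : C}

/-- The object of `P` underlying a path over the base-section `P`. [cite: MochizukiFrdI2008, Thm.
5.2(iv) p.101] -/
def pobj (p : FPPath F {A | P.obj A} X) : P.Cat := ⟨p.A, p.mem⟩

variable (Fr) in
/-- The `F`-distinguished endomorphism `F(d)_A : A → A` of the path object.
[cite: MochizukiFrdI2008, Def. 2.7(ii) p.51] -/
def frob (p : FPPath F {A | P.obj A} X) (d : ℕ+) : p.A ⟶ p.A := (Fr d).app p.pobj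

/-- `deg_Fr F(d)_A = d`. [cite: MochizukiFrdI2008, Def. 2.7(ii) p.51] -/
theorem degFr_frob (hPF : IsBaseFrobeniusPair F P Fr) (p : FPPath F {A | P.obj A} X) (d : ℕ+) :
    degFr F (p.frob Fr d) = d :=
  hPF.isFrobeniusSection.degFr_eq d p.pobj

/-- `Base F(d)_A = id`. [cite: MochizukiFrdI2008, Def. 2.7(ii) p.51] -/
theorem base_frob (hPF : IsBaseFrobeniusPair F P Fr) (p : FPPath F {A | P.obj A} X) (d : ℕ+) :
    Base F (p.frob Fr d) = 𝟙 _ :=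
  hPF.isFrobeniusSection.isBaseIdentity d p.pobj

/-- `Div F(d)_A = 0` (Frobenius type). [cite: MochizukiFrdI2008, Def. 2.7(ii) p.51] -/
theorem div_frob (hPF : IsBaseFrobeniusPair F P Fr) (p : FPPath F {A | P.obj A} X) (d : ℕ+) :
    Div F (p.frob Fr d) = 1 :=
  (hPF.isFrobeniusSection.isFrobeniusType d p.pobj).1.2

/-- **The `P`-part**: the `P`-morphism `π_φ : A → A'` over `baseOf φ` (chosen; unique by
`IsBaseSection.existsUnique_hom_over`). [cite: MochizukiFrdI2008, Thm. 5.2(iv) p.102] -/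
noncomputable def ppart (hP : IsBaseSection F P) (p : FPPath F {A | P.obj A} X)
    (p' : FPPath F {A | P.obj A} X') (φ : X ⟶ X') : p.A ⟶ p'.A :=
  ((hP.existsUnique_hom_over p.pobj p'.pobj (baseOf p p' φ)).exists.choose).1

/-- `π_φ ∈ P`. [cite: MochizukiFrdI2008, Thm. 5.2(iv) p.102] -/
theorem ppart_mem (hP : IsBaseSection F P) (p : FPPath F {A | P.obj A} X)
    (p' : FPPath F {A | P.obj A} X') (φ : X ⟶ X') : P.hom (ppart hP p p' φ) :=
  ((hP.existsUnique_hom_over p.pobj p'.pobj (baseOf p p' φ)).exists.choose).2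

/-- `Base(π_φ) = baseOf φ`. [cite: MochizukiFrdI2008, Thm. 5.2(iv) p.102] -/
theorem base_ppart (hP : IsBaseSection F P) (p : FPPath F {A | P.obj A} X)
    (p' : FPPath F {A | P.obj A} X') (φ : X ⟶ X') : Base F (ppart hP p p' φ) = baseOf p p' φ :=
  (hP.existsUnique_hom_over p.pobj p'.pobj (baseOf p p' φ)).exists.choose_spec

/-- `π_φ` is a pull-back morphism (`P ⊆ C^pl-bk`). [cite: MochizukiFrdI2008, Def. 2.7(i) p.51] -/
theorem isPullbackMorphism_ppart (hP : IsBaseSection F P) (p : FPPath F {A | P.obj A} X)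
    (p' : FPPath F {A | P.obj A} X') (φ : X ⟶ X') : IsPullbackMorphism F (ppart hP p p' φ) :=
  hP.hom_pullback _ (ppart_mem hP p p' φ)

/-- Uniqueness of the `P`-part among `P`-morphisms over the same base map.
[cite: MochizukiFrdI2008, Thm. 5.2(iv) p.102] -/
theorem ppart_unique (hP : IsBaseSection F P) (p : FPPath F {A | P.obj A} X)
    (p' : FPPath F {A | P.obj A} X') (φ : X ⟶ X') {π : p.A ⟶ p'.A} (hπ : P.hom π)
    (hb : Base F π = baseOf p p' φ) : π = ppart hP p p' φ := by
  have h := (hP.existsUnique_hom_over p.pobj p'.pobj (baseOf p p' φ)).unique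
    (y₁ := ⟨π, hπ⟩) (y₂ := ⟨ppart hP p p' φ, ppart_mem hP p p' φ⟩) hb (base_ppart hP p p' φ)
  exact congrArg Subtype.val h

/-- **The factorisation** `pathHom φ = F(d)_A^birat ≫ u ≫ π_φ^birat` with `u ∈ O^×(A^birat)`,
`d = deg_Fr φ` (existence). [cite: MochizukiFrdI2008, Thm. 5.2(iv) p.102] -/
theorem exists_unit_pathHom (hPF : IsBaseFrobeniusPair F P Fr) (hiso : IsOfIsotropicType F)
    (p : FPPath F {A | P.obj A} X) (p' : FPPath F {A | P.obj A} X') (φ : X ⟶ X') :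
    ∃ u : BiratUnits F hF p.A, pathHom hF hsq p p' φ =
      (toBirat F hF hsq).map (p.frob Fr (degFr F φ)) ≫ BiratUnits.toHom hsq u ≫
        (toBirat F hF hsq).map (ppart hPF.isBaseSection p p' φ) := by
  have hπb : IsPullbackMorphism (Birat.toElemGp hF hsq)
      ((toBirat F hF hsq).map (ppart hPF.isBaseSection p p' φ)) :=
    Birat.isPullbackMorphism_toBirat_map (isPullbackMorphism_ppart hPF.isBaseSection p p' φ)
  -- lift `ψ` along `π^birat` over the identity of `Base A`
  have hb : Base (Birat.toElemGp hF hsq) (pathHom hF hsq p p' φ) =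
      𝟙 _ ≫
        Base (Birat.toElemGp hF hsq) ((toBirat F hF hsq).map (ppart hPF.isBaseSection p p' φ)) := by
    rw [Category.id_comp, base_pathHom_eq_baseOf, Birat.base_toBirat_map, base_ppart]
  obtain ⟨ψ₀, hψ₀, hψ₀b⟩ := hπb.exists_lift (pathHom hF hsq p p' φ) (𝟙 _) hb
  obtain ⟨f₀, rfl⟩ := Birat.homMk_surjective ψ₀
  -- `ψ₀ = [(β₀, χ₀)]` is base-identity of degree `deg φ`
  haveI : IsIso (Base F f₀.den) := f₀.den_mem.2.2
  have hbase : Base F f₀.num = Base F f₀.den := by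
    have h : inv (Base F f₀.den) ≫ Base F f₀.num = 𝟙 (baseObj F p.A) := hψ₀b
    exact ((IsIso.inv_comp_eq _).mp h).trans (Category.comp_id _)
  have hdeg : degFr F f₀.num = degFr F (p.frob Fr (degFr F φ)) := by
    have h1 := congrArg (degFr (Birat.toElemGp hF hsq)) hψ₀
    have h2 : degFr (Birat.toElemGp hF hsq) (pathHom hF hsq p p' φ) = degFr F φ :=
      degFr_pathHom p p' φ
    have h3 : degFr (Birat.toElemGp hF hsq)
        ((toBirat F hF hsq).map (ppart hPF.isBaseSection p p' φ)) = 1 :=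
      (hF.iv_b _ (isPullbackMorphism_ppart hPF.isBaseSection p p' φ)).2
    have h4 : degFr (Birat.toElemGp hF hsq) (Birat.homMk f₀ ≫
        (toBirat F hF hsq).map (ppart hPF.isBaseSection p p' φ)) =
        degFr F f₀.num * 1 := by
      rw [← h3]
      exact degFr_comp _ _ _
    rw [degFr_frob hPF, ← h2, ← h1, h4, mul_one]
  obtain ⟨u, hu⟩ := BiratUnits.exists_unit_factor (hsq := hsq) hiso f₀.den f₀.num f₀.den_mem hbase
    (p.frob Fr (degFr F φ)) (base_frob hPF p _) hdeg
  refine ⟨u, hψ₀.symm.trans ?_⟩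
  exact (congrArg (· ≫ (toBirat F hF hsq).map (ppart hPF.isBaseSection p p' φ)) hu.symm).trans
    (Category.assoc _ _ _)

/-- The factorisation determines `u` uniquely (given the `F`- and `P`-parts): cancel `π^birat` by
the
universal property of the pull-back, then `F(d)^birat` (an epimorphism).
[cite: MochizukiFrdI2008, Thm. 5.2(iv) p.102] -/
theorem unit_pathHom_unique (hPF : IsBaseFrobeniusPair F P Fr) (p : FPPath F {A | P.obj A} X)
    (p' : FPPath F {A | P.obj A} X') (φ : X ⟶ X') {u u' : BiratUnits F hF p.A}
    (hu : pathHom hF hsq p p' φ = (toBirat F hF hsq).map (p.frob Fr (degFr F φ)) ≫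
      BiratUnits.toHom hsq u ≫ (toBirat F hF hsq).map (ppart hPF.isBaseSection p p' φ))
    (hu' : pathHom hF hsq p p' φ = (toBirat F hF hsq).map (p.frob Fr (degFr F φ)) ≫
      BiratUnits.toHom hsq u' ≫ (toBirat F hF hsq).map (ppart hPF.isBaseSection p p' φ)) :
    u = u' := by
  have hπb : IsPullbackMorphism (Birat.toElemGp hF hsq)
      ((toBirat F hF hsq).map (ppart hPF.isBaseSection p p' φ)) :=
    Birat.isPullbackMorphism_toBirat_map (isPullbackMorphism_ppart hPF.isBaseSection p p' φ)
  obtain ⟨q, rfl⟩ := BiratUnits.mk_surjective u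
  obtain ⟨q', rfl⟩ := BiratUnits.mk_surjective u'
  haveI : IsIso (Base F q.den) := q.den_mem.2.2
  haveI : IsIso (Base F q'.den) := q'.den_mem.2.2
  -- base maps of the two middle parts agree (both are identities)
  have hbq : ∀ r : RatFrac F p.A,
      Base (Birat.toElemGp hF hsq) (BiratUnits.toHom hsq (BiratUnits.mk hF r)) = 𝟙 _ := fun r => by
    haveI : IsIso (Base F r.den) := r.den_mem.2.2
    rw [BiratUnits.toHom_mk]
    change inv (Base F r.den) ≫ Base F r.num = 𝟙 _
    rw [← r.baseEq, IsIso.inv_hom_id]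
  have h1 : (toBirat F hF hsq).map (p.frob Fr (degFr F φ)) ≫
        BiratUnits.toHom hsq (BiratUnits.mk hF q) =
      (toBirat F hF hsq).map (p.frob Fr (degFr F φ)) ≫
        BiratUnits.toHom hsq (BiratUnits.mk hF q') := by
    apply hπb.hom_ext
    · rw [Category.assoc, Category.assoc, ← hu, ← hu']
    · rw [base_comp, base_comp, hbq, hbq]
  exact BiratUnits.unit_factor_unique _ h1

/-- **The divisor of the unit part**: `divHom u = Div(pathHom φ)` in `Φ^gp(A_D)` — the `F`-part
(Frobenius type) and the `P`-part (a pull-back morphism) are isometries of degree `d` and `1`.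
[cite: MochizukiFrdI2008, Thm. 5.2(iv) p.102] -/
theorem divHom_unit_pathHom (hPF : IsBaseFrobeniusPair F P Fr) (p : FPPath F {A | P.obj A} X)
    (p' : FPPath F {A | P.obj A} X') (φ : X ⟶ X') {u : BiratUnits F hF p.A}
    (hu : pathHom hF hsq p p' φ = (toBirat F hF hsq).map (p.frob Fr (degFr F φ)) ≫
      BiratUnits.toHom hsq u ≫ (toBirat F hF hsq).map (ppart hPF.isBaseSection p p' φ)) :
    BiratUnits.divHom hF p.A u = Birat.gpDiv (pathHom hF hsq p p' φ) := by
  have hπiso : Div F (ppart hPF.isBaseSection p p' φ) = 1 :=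
    (hF.iv_b _ (isPullbackMorphism_ppart hPF.isBaseSection p p' φ)).1.2
  have hπlin : degFr F (ppart hPF.isBaseSection p p' φ) = 1 :=
    (hF.iv_b _ (isPullbackMorphism_ppart hPF.isBaseSection p p' φ)).2
  obtain ⟨q, rfl⟩ := BiratUnits.mk_surjective u
  have hbu : Birat.gpBase (BiratUnits.toHom hsq (BiratUnits.mk hF q)) = 𝟙 _ := by
    haveI : IsIso (Base F q.den) := q.den_mem.2.2
    rw [BiratUnits.toHom_mk]
    change inv (Base F q.den) ≫ Base F q.num = 𝟙 _
    rw [← q.baseEq, IsIso.inv_hom_id]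
  have hdu : Birat.gpDiv (BiratUnits.toHom hsq (BiratUnits.mk hF q)) = RatFrac.div q :=
    BiratFrac.divGp_toBiratFrac q
  rw [hu, Birat.gpDiv_comp, Birat.gpDiv_comp, Birat.gpDeg_comp, Birat.gpDiv_map, Birat.gpDiv_map,
    Birat.gpBase_map, Birat.gpDeg_map, hπiso, hπlin, div_frob hPF, base_frob hPF, hbu, hdu,
    BiratUnits.divHom_mk]
  simp only [map_one, PNat.one_coe, pow_one, one_mul, mul_one, pullGp_id, one_pow]

end FPPath

end PreFrobenioid

end Literature.AlgebraicGeometry.Frobenioids
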